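/-
Copyright (c) 2026 the pub-hodgecm-mathlib formalisation cell (harness21).  Prover seat hodgecm-mathlib-LH4-p10 (g5), req620 Track A «(D-RAM) FOUR-FRAME» squad, helper lane
on h413 = stmt-HodgeConjecture-24833 (count-neutral).  STAGE-1b scoping brick (N-vol-wild) FILE 4d (dealer LH4-plan (g12) WORD #37∕#45; LH4-p08 (g7) 10:04Z «that digit is the
ONLY remaining input of row (3)»): THE SHELL AND THE UNLABELLED-HALF FIBRE VOLUMES — `pieceTransvMinus = shell ∧ ¬LabelPlus`, in `μ_N` and `μ_N.real` currency.  2026-09-04.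
-/
import Summits.HodgeConjecture.HodgeConjecture.Theorems.F0P3cDyRamTransvPlusUnipotentVolume   -- ★ p859349 FILE 4c (this seat): `measure_setOf_mem_and_nearTransvShell_and_labelPlus_eq` (ρ_{T+}); brings ★ FILE 4b∕4a∕3∕2∕1, ★ DEFS №3
import Literature.NumberTheory.Automorphic.CMBorelUnipotentIndexModulus                       -- ★ `isClosed_cmBorelTriple_N` (`N` closed in `U(Φ₃)(L⁺_v)`, finiteness of `μ_N{n ∈ K₃}`)
import HarnessLib

/-!
# Crux `H413`, line LH4 «(D-RAM) FOUR-FRAME» — THE SHELL AND THE `¬LabelPlus` FIBRE VOLUMES: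
# `μ_N{n ∈ K₃ : shell} = (1 − q⁻¹)·q^{−(d − ⌊d∕2⌋)}·μ_N{n ∈ K₃}`, `μ_N{n ∈ K₃ : shell ∧ ¬LabelPlus} = shell − plus` (`d ≥ 2`, every Haar `μ_N`)

Cell `hodgecm-mathlib` (D-0151), FLOOR 0, crux item H413 = `stmt-HodgeConjecture-24833`, route of record `HCCMUnconditional`; squad F0∕P3c∕LH4 (req618∕req620); helper lane
`--supports stmt-HodgeConjecture-24833 --as helper` (count-neutral).  THEOREMS ONLY (no `def`, no instance, no notation, no `sorry`).

WHAT.  At a WILD ramified non-split CM place `w ∣ v` (`IsRamifiedQuadraticDatum σ_w ϖ d t`, `2 ≤ d`; `ℓ₀ = d % 2`, `m* = ℓ₀ + 2d − 1`, `k_c = (ℓ₀ + 3d − 1)∕2`, `q = N𝔭_v`),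
for EVERY Haar measure `μ_N` of `N = unipotentU (c ⊗ 1) Φ₃` and with `X = n_w − 1` (`n_w = ((n : U) : GL₃ R).val.map (evalRingHom w)` = ★ `wMatrix`):
* §2 the sets `{n ∈ K₃ : NearTransvShell ϖ ℓ m X}`, `{… ∧ LabelPlus σ_w ϖ d m′ X}`, `{… ∧ ¬LabelPlus …}` are MEASURABLE (the label locus `{n : LabelPlus … X}` is OPEN in `N` —
  ★ FILE 4b's chart statement pushed through the chart homeomorphism ★ p859078), and `μ_N{n ∈ K₃} < ∞` (`K₃` compact, `N` closed);
* §3 **`μ_N{n ∈ K₃ : NearTransvShell ϖ ℓ₀ m* X} = ((1 − q⁻¹)·(q^{d − ⌊d∕2⌋})⁻¹) • μ_N{n ∈ K₃}`** (the shell is `levels(ℓ₀, m*) ∖ levels(ℓ₀+1, m*)`, ★ p859102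
  `measure_setOf_mem_and_levels_eq` at exponents `d − ⌊d∕2⌋` and `d − ⌊d∕2⌋ + 1`);
* §4 **`μ_N{n ∈ K₃ : shell ∧ ¬LabelPlus} = ((1 − q⁻¹)(q^{d − ⌊d∕2⌋})⁻¹ − ((1 − q⁻¹)∕2)(q^{k_c − ⌊d∕2⌋})⁻¹) • μ_N{n ∈ K₃}`** = shell − plus (★ p859349) — TOKEN FOR TOKEN the
  support of ★ DEFS №3 `pieceTransvMinus` at `dOfPlace = d`, `mstarFn = m*`;
* §5 the three volumes in `μ_N.real` currency (the form LH4-p08 (g7)'s row-(3) chain ★ p858969∕p859150∕p859211 consumes via `integral_indicator`):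
  `ρ_{T+} = ½(1 − q⁻¹)q^{−(k_c − ⌊d∕2⌋)}`, `ρ_shell = (1 − q⁻¹)q^{−(d − ⌊d∕2⌋)}`, `ρ_{T−} = ρ_shell − ρ_{T+}` (REAL subtraction).
DIGIT (for the LEAD ∕ REF5 R5-3): `ρ_{T+} = ρ_shell∕2` iff `d = 2`; for `d ≥ 3` the shallow band `d ≤ v_w(x) < k_c` of the shell is label-free (★ p859171
`not_labelPlus_heis_of_shallow`) and is absorbed by `pieceTransvMinus`, so `ρ_{T−} − ρ_{T+} = (1 − q⁻¹)(q^{−(d−⌊d∕2⌋)} − q^{−(k_c−⌊d∕2⌋)}) > 0`.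
HONEST LABEL: count-neutral scoping, pays no row by itself; HC_CM is proved only modulo the 7 printed citations (2 remaining named inputs: hLiu418 = `stmt-HodgeConjecture-24832`,
h413 = `stmt-HodgeConjecture-24833`) until rung 0 closes.

## References
* [Rogawski1990] J. D. Rogawski, *Automorphic Representations of Unitary Groups in Three Variables*, Ann. of Math. Stud. 123 (1990), §4.9 Prop. 4.9.1 (b) p. 55; §1.10 p. 9.
* [Serre1979] J.-P. Serre, *Local Fields*, GTM 67 (1979), Ch. V §3 Cor. 3, Ch. XV §2 (norm classes, conductor).
* [Kottwitz1986BaseChangeUnits] R. E. Kottwitz, *Base change for unit elements of Hecke algebras*, Compositio Math. 60 (1986), §1 pp. 240–241 (level pieces, fibre volumes).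
* [LanglandsShelstad1987] R. P. Langlands, D. Shelstad, *On the definition of transfer factors*, Math. Ann. 278 (1987), §3 (the two unipotent classes).
-/

set_option autoImplicit false

noncomputable section

open IsDedekindDomain NumberField Matrix MeasureTheory Measure Topology
open scoped NumberField MatrixGroups Matrix NNReal ENNReal WithZero Pointwise Valued

namespace Summit.HodgeConjecture.HodgeConjecture.Cruxes.H413.F0P3cDyRamTransvMinusUnipotentVolume

open Literature.NumberTheory.Automorphic Literature.NumberTheory.Automorphic.UnitaryGroup Literature.NumberTheory.Automorphic.IntegralReduction
open Literature.NumberTheory.Automorphic.UnitaryLatticeTree Literature.NumberTheory.Automorphic.HermitianLattice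
open Literature.NumberTheory.GaloisRepresentations Literature.NumberTheory.LocalFields
open Summit.HodgeConjecture.HodgeConjecture.Cruxes.H413.F0P3cDyRamFourFramePieces
open Summit.HodgeConjecture.HodgeConjecture.Cruxes.H413.F0P3cDyRamUnipotentLabelLocus
open Summit.HodgeConjecture.HodgeConjecture.Cruxes.H413.F0P3cDyRamTransvPlusUnipotentVolume

variable (L : Type) [Field L] [NumberField L] [IsCMField L] (v : HeightOneSpectrum (𝓞 ↥(maximalRealSubfield L)))
  (w : PlacesOver L v) (hw : IsCMField.complexConj L • w.1 = w.1)

/-! ## §1 Scalar bookkeeping -/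

/-- `a • X − b • X = (a − b) • X` for `ℝ≥0`-scalars on a FINITE `X : ℝ≥0∞` (truncated subtraction on both sides). -/
theorem ENNReal.sub_smul_of_ne_top (a b : ℝ≥0) {X : ℝ≥0∞} (hX : X ≠ ⊤) : a • X - b • X = ((a - b : ℝ≥0)) • X := by
  rw [ENNReal.smul_def, ENNReal.smul_def, ENNReal.smul_def, smul_eq_mul, smul_eq_mul, smul_eq_mul, ← ENNReal.sub_mul (fun _ _ => hX), ENNReal.coe_sub]

/-- `(q^e)⁻¹ − (q^{e+1})⁻¹ = (1 − q⁻¹)·(q^e)⁻¹` in `ℝ≥0` (`1 ≤ q`). -/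
theorem NNReal.inv_pow_sub_inv_pow_succ {q : ℝ≥0} (hq : 1 ≤ q) (e : ℕ) : (q ^ e)⁻¹ - (q ^ (e + 1))⁻¹ = (1 - q⁻¹) * (q ^ e)⁻¹ := by
  have hq0 : 0 < q := zero_lt_one.trans_le hq
  have hle : (q ^ (e + 1))⁻¹ ≤ (q ^ e)⁻¹ := inv_anti₀ (pow_pos hq0 e) (pow_le_pow_right₀ hq e.le_succ)
  have hle1 : q⁻¹ ≤ 1 := inv_le_one_of_one_le₀ hq
  apply NNReal.eq
  rw [NNReal.coe_sub hle, NNReal.coe_mul, NNReal.coe_sub hle1]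
  push_cast
  rw [pow_succ, mul_inv]
  ring

omit [IsCMField L] in
/-- `1 ≤ N𝔭_v` in `ℝ≥0`. -/
theorem one_le_absNorm_nnreal : (1 : ℝ≥0) ≤ (Ideal.absNorm v.asIdeal : ℝ≥0) :=
  Nat.one_le_cast.2 (Nat.pos_of_ne_zero (by rw [Ne, Ideal.absNorm_eq_zero_iff]; exact v.ne_bot))

/-! ## §2 Measurability on `N`: the label locus is open; the shell pieces are measurable; `μ_N{n ∈ K₃} < ∞` -/

include hw in
/-- **The label locus `{n ∈ N : LabelPlus σ_w ϖ d m (n_w − 1)}` is OPEN in `N`** (★ FILE 4b `isOpen_setOf_labelPlus_chart` through the chart homeomorphism `(x, y) ↦ u(x, z)`,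
★ `map_heisElt_sub_one_eq`). [cite: Rogawski1990, §4.9 Prop. 4.9.1 (b) p. 55; §1.10 p. 9] -/
theorem isOpen_setOf_labelPlus {ϖ : w.1.adicCompletion L} (hϖ : Valued.v ϖ = WithZero.exp (-1 : ℤ)) (d m : ℕ) :
    IsOpen {n : ↥(unipotentU (conjLocal L (IsCMField.complexConj L) v) (cmLocalForm L 3 v)) |
        LabelPlus (galAdicCompletionMap (L := L) (IsCMField.complexConj L) hw) ϖ d m
            (((n : ↥(unitaryGroupOfForm (conjLocal L (IsCMField.complexConj L) v) (cmLocalForm L 3 v))) : GL (Fin 3) (LocalRing L v)).val.map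
                (Pi.evalRingHom (fun w' : PlacesOver L v => w'.1.adicCompletion L) w) - 1)} := by
  letI : Invertible (2 : LocalRing L v) := (isUnit_two_localRing L v).invertible
  have hσw : ∀ r : LocalRing L v, conjLocal L (IsCMField.complexConj L) v r w = galAdicCompletionMap (L := L) (IsCMField.complexConj L) hw (r w) :=
    fun r => conjLocal_apply_eq_of_smul_eq (IsCMField.complexConj L) (IsCMField.complexConj_ne_one L) v w hw r
  refine ((HeisRing.heisHomeomorph (conjLocal L (IsCMField.complexConj L) v) (conjLocal_conjLocal_cm L v) (continuous_conjLocal L (IsCMField.complexConj L) v)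
    (cmLocalForm_eq_over L 3 v)).isOpen_preimage).1 ?_
  convert isOpen_setOf_labelPlus_chart L v w hw hϖ d m using 1
  ext ⟨x, y⟩
  simp only [Set.mem_preimage, Set.mem_setOf_eq, HeisRing.heisHomeomorph_apply]
  rw [map_heisElt_sub_one_eq L v w x y, hσw x]

/-- `{n ∈ K₃ : NearTransvShell ϖ ℓ m X} = {n ∈ K₃ : X ∈ ϖ^ℓ M₃, X² ∈ ϖ^m M₃} ∖ {n ∈ K₃ : X ∈ ϖ^{ℓ+1} M₃, X² ∈ ϖ^m M₃}` (★ p859102's level sets, TOKEN FOR TOKEN).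
[cite: Kottwitz1986BaseChangeUnits, §1 pp. 240–241] -/
theorem setOf_mem_and_nearTransvShell_eq_diff (ϖ : w.1.adicCompletion L) (ℓ m : ℕ) :
    {n : ↥(unipotentU (conjLocal L (IsCMField.complexConj L) v) (cmLocalForm L 3 v)) |
        (n : ↥(unitaryGroupOfForm (conjLocal L (IsCMField.complexConj L) v) (cmLocalForm L 3 v))) ∈
            cmLocalIntegralLevel L 3 (Matrix.of fun i j : Fin 3 => if i.val + j.val + 1 = 3 then (1 : L) else 0) v ∧
          NearTransvShell ϖ ℓ m
            (((n : ↥(unitaryGroupOfForm (conjLocal L (IsCMField.complexConj L) v) (cmLocalForm L 3 v))) : GL (Fin 3) (LocalRing L v)).val.map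
                (Pi.evalRingHom (fun w' : PlacesOver L v => w'.1.adicCompletion L) w) - 1)} =
      {n : ↥(unipotentU (conjLocal L (IsCMField.complexConj L) v) (cmLocalForm L 3 v)) | (n : ↥(unitaryGroupOfForm (conjLocal L (IsCMField.complexConj L) v) (cmLocalForm L 3 v))) ∈
            cmLocalIntegralLevel L 3 (Matrix.of fun i j : Fin 3 => if i.val + j.val + 1 = 3 then (1 : L) else 0) v ∧
          (∀ i j : Fin 3, Valued.v ((ϖ ^ ℓ)⁻¹ *
            (((n : ↥(unitaryGroupOfForm (conjLocal L (IsCMField.complexConj L) v) (cmLocalForm L 3 v))) : GL (Fin 3) (LocalRing L v)).val.map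
                (Pi.evalRingHom (fun w' : PlacesOver L v => w'.1.adicCompletion L) w) - 1) i j) ≤ 1) ∧
          ∀ i j : Fin 3, Valued.v ((ϖ ^ m)⁻¹ *
            ((((n : ↥(unitaryGroupOfForm (conjLocal L (IsCMField.complexConj L) v) (cmLocalForm L 3 v))) : GL (Fin 3) (LocalRing L v)).val.map
                (Pi.evalRingHom (fun w' : PlacesOver L v => w'.1.adicCompletion L) w) - 1) *
             (((n : ↥(unitaryGroupOfForm (conjLocal L (IsCMField.complexConj L) v) (cmLocalForm L 3 v))) : GL (Fin 3) (LocalRing L v)).val.map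
                (Pi.evalRingHom (fun w' : PlacesOver L v => w'.1.adicCompletion L) w) - 1)) i j) ≤ 1} \
      {n : ↥(unipotentU (conjLocal L (IsCMField.complexConj L) v) (cmLocalForm L 3 v)) | (n : ↥(unitaryGroupOfForm (conjLocal L (IsCMField.complexConj L) v) (cmLocalForm L 3 v))) ∈
            cmLocalIntegralLevel L 3 (Matrix.of fun i j : Fin 3 => if i.val + j.val + 1 = 3 then (1 : L) else 0) v ∧
          (∀ i j : Fin 3, Valued.v ((ϖ ^ (ℓ + 1))⁻¹ *
            (((n : ↥(unitaryGroupOfForm (conjLocal L (IsCMField.complexConj L) v) (cmLocalForm L 3 v))) : GL (Fin 3) (LocalRing L v)).val.map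
                (Pi.evalRingHom (fun w' : PlacesOver L v => w'.1.adicCompletion L) w) - 1) i j) ≤ 1) ∧
          ∀ i j : Fin 3, Valued.v ((ϖ ^ m)⁻¹ *
            ((((n : ↥(unitaryGroupOfForm (conjLocal L (IsCMField.complexConj L) v) (cmLocalForm L 3 v))) : GL (Fin 3) (LocalRing L v)).val.map
                (Pi.evalRingHom (fun w' : PlacesOver L v => w'.1.adicCompletion L) w) - 1) *
             (((n : ↥(unitaryGroupOfForm (conjLocal L (IsCMField.complexConj L) v) (cmLocalForm L 3 v))) : GL (Fin 3) (LocalRing L v)).val.map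
                (Pi.evalRingHom (fun w' : PlacesOver L v => w'.1.adicCompletion L) w) - 1)) i j) ≤ 1} := by
  ext n
  simp only [Set.mem_setOf_eq, Set.mem_sdiff, NearTransvShell, InLevel]
  tauto

include hw in
/-- `{n ∈ K₃ : shell ∧ ¬LabelPlus} = {n ∈ K₃ : shell} ∖ {n ∈ K₃ : shell ∧ LabelPlus}` (the support of ★ DEFS №3 `pieceTransvMinus` is shell minus plus).
[cite: Rogawski1990, §4.9 Prop. 4.9.1 (b) p. 55] -/
theorem setOf_mem_and_nearTransvShell_and_not_labelPlus_eq_diff (ϖ : w.1.adicCompletion L) (ℓ m d m' : ℕ) :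
    {n : ↥(unipotentU (conjLocal L (IsCMField.complexConj L) v) (cmLocalForm L 3 v)) |
        (n : ↥(unitaryGroupOfForm (conjLocal L (IsCMField.complexConj L) v) (cmLocalForm L 3 v))) ∈
            cmLocalIntegralLevel L 3 (Matrix.of fun i j : Fin 3 => if i.val + j.val + 1 = 3 then (1 : L) else 0) v ∧
          NearTransvShell ϖ ℓ m
            (((n : ↥(unitaryGroupOfForm (conjLocal L (IsCMField.complexConj L) v) (cmLocalForm L 3 v))) : GL (Fin 3) (LocalRing L v)).val.map
                (Pi.evalRingHom (fun w' : PlacesOver L v => w'.1.adicCompletion L) w) - 1) ∧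
          ¬ LabelPlus (galAdicCompletionMap (L := L) (IsCMField.complexConj L) hw) ϖ d m'
            (((n : ↥(unitaryGroupOfForm (conjLocal L (IsCMField.complexConj L) v) (cmLocalForm L 3 v))) : GL (Fin 3) (LocalRing L v)).val.map
                (Pi.evalRingHom (fun w' : PlacesOver L v => w'.1.adicCompletion L) w) - 1)} =
      {n : ↥(unipotentU (conjLocal L (IsCMField.complexConj L) v) (cmLocalForm L 3 v)) |
        (n : ↥(unitaryGroupOfForm (conjLocal L (IsCMField.complexConj L) v) (cmLocalForm L 3 v))) ∈
            cmLocalIntegralLevel L 3 (Matrix.of fun i j : Fin 3 => if i.val + j.val + 1 = 3 then (1 : L) else 0) v ∧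
          NearTransvShell ϖ ℓ m
            (((n : ↥(unitaryGroupOfForm (conjLocal L (IsCMField.complexConj L) v) (cmLocalForm L 3 v))) : GL (Fin 3) (LocalRing L v)).val.map
                (Pi.evalRingHom (fun w' : PlacesOver L v => w'.1.adicCompletion L) w) - 1)} \
      {n : ↥(unipotentU (conjLocal L (IsCMField.complexConj L) v) (cmLocalForm L 3 v)) |
        (n : ↥(unitaryGroupOfForm (conjLocal L (IsCMField.complexConj L) v) (cmLocalForm L 3 v))) ∈
            cmLocalIntegralLevel L 3 (Matrix.of fun i j : Fin 3 => if i.val + j.val + 1 = 3 then (1 : L) else 0) v ∧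
          NearTransvShell ϖ ℓ m
            (((n : ↥(unitaryGroupOfForm (conjLocal L (IsCMField.complexConj L) v) (cmLocalForm L 3 v))) : GL (Fin 3) (LocalRing L v)).val.map
                (Pi.evalRingHom (fun w' : PlacesOver L v => w'.1.adicCompletion L) w) - 1) ∧
          LabelPlus (galAdicCompletionMap (L := L) (IsCMField.complexConj L) hw) ϖ d m'
            (((n : ↥(unitaryGroupOfForm (conjLocal L (IsCMField.complexConj L) v) (cmLocalForm L 3 v))) : GL (Fin 3) (LocalRing L v)).val.map
                (Pi.evalRingHom (fun w' : PlacesOver L v => w'.1.adicCompletion L) w) - 1)} := by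
  ext n
  simp only [Set.mem_setOf_eq, Set.mem_sdiff]
  tauto

include hw in
/-- `{n ∈ K₃ : NearTransvShell ϖ ℓ m (n_w − 1)}` is measurable (difference of two closed level sets, ★ p859102 `isClosed_setOf_mem_and_levels`).
[cite: Kottwitz1986BaseChangeUnits, §1 pp. 240–241] -/
theorem measurableSet_setOf_mem_and_nearTransvShell [MeasurableSpace ↥(unipotentU (conjLocal L (IsCMField.complexConj L) v) (cmLocalForm L 3 v))] [BorelSpace ↥(unipotentU (conjLocal L (IsCMField.complexConj L) v) (cmLocalForm L 3 v))]
    {ϖ : w.1.adicCompletion L} (hϖ : Valued.v ϖ = WithZero.exp (-1 : ℤ)) (ℓ m : ℕ) :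
    MeasurableSet {n : ↥(unipotentU (conjLocal L (IsCMField.complexConj L) v) (cmLocalForm L 3 v)) |
        (n : ↥(unitaryGroupOfForm (conjLocal L (IsCMField.complexConj L) v) (cmLocalForm L 3 v))) ∈
            cmLocalIntegralLevel L 3 (Matrix.of fun i j : Fin 3 => if i.val + j.val + 1 = 3 then (1 : L) else 0) v ∧
          NearTransvShell ϖ ℓ m
            (((n : ↥(unitaryGroupOfForm (conjLocal L (IsCMField.complexConj L) v) (cmLocalForm L 3 v))) : GL (Fin 3) (LocalRing L v)).val.map
                (Pi.evalRingHom (fun w' : PlacesOver L v => w'.1.adicCompletion L) w) - 1)} := by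
  rw [setOf_mem_and_nearTransvShell_eq_diff L v w ϖ ℓ m]
  exact (isClosed_setOf_mem_and_levels L v w hw hϖ ℓ m).measurableSet.diff (isClosed_setOf_mem_and_levels L v w hw hϖ (ℓ + 1) m).measurableSet

include hw in
/-- `{n ∈ K₃ : NearTransvShell ϖ ℓ m (n_w − 1) ∧ LabelPlus σ_w ϖ d m′ (n_w − 1)}` is measurable. [cite: Rogawski1990, §4.9 Prop. 4.9.1 (b) p. 55] -/
theorem measurableSet_setOf_mem_and_nearTransvShell_and_labelPlus [MeasurableSpace ↥(unipotentU (conjLocal L (IsCMField.complexConj L) v) (cmLocalForm L 3 v))] [BorelSpace ↥(unipotentU (conjLocal L (IsCMField.complexConj L) v) (cmLocalForm L 3 v))]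
    {ϖ : w.1.adicCompletion L} (hϖ : Valued.v ϖ = WithZero.exp (-1 : ℤ)) (ℓ m d m' : ℕ) :
    MeasurableSet {n : ↥(unipotentU (conjLocal L (IsCMField.complexConj L) v) (cmLocalForm L 3 v)) |
        (n : ↥(unitaryGroupOfForm (conjLocal L (IsCMField.complexConj L) v) (cmLocalForm L 3 v))) ∈
            cmLocalIntegralLevel L 3 (Matrix.of fun i j : Fin 3 => if i.val + j.val + 1 = 3 then (1 : L) else 0) v ∧
          NearTransvShell ϖ ℓ m
            (((n : ↥(unitaryGroupOfForm (conjLocal L (IsCMField.complexConj L) v) (cmLocalForm L 3 v))) : GL (Fin 3) (LocalRing L v)).val.map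
                (Pi.evalRingHom (fun w' : PlacesOver L v => w'.1.adicCompletion L) w) - 1) ∧
          LabelPlus (galAdicCompletionMap (L := L) (IsCMField.complexConj L) hw) ϖ d m'
            (((n : ↥(unitaryGroupOfForm (conjLocal L (IsCMField.complexConj L) v) (cmLocalForm L 3 v))) : GL (Fin 3) (LocalRing L v)).val.map
                (Pi.evalRingHom (fun w' : PlacesOver L v => w'.1.adicCompletion L) w) - 1)} := by
  rw [show {n : ↥(unipotentU (conjLocal L (IsCMField.complexConj L) v) (cmLocalForm L 3 v)) |
        (n : ↥(unitaryGroupOfForm (conjLocal L (IsCMField.complexConj L) v) (cmLocalForm L 3 v))) ∈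
            cmLocalIntegralLevel L 3 (Matrix.of fun i j : Fin 3 => if i.val + j.val + 1 = 3 then (1 : L) else 0) v ∧
          NearTransvShell ϖ ℓ m
            (((n : ↥(unitaryGroupOfForm (conjLocal L (IsCMField.complexConj L) v) (cmLocalForm L 3 v))) : GL (Fin 3) (LocalRing L v)).val.map
                (Pi.evalRingHom (fun w' : PlacesOver L v => w'.1.adicCompletion L) w) - 1) ∧
          LabelPlus (galAdicCompletionMap (L := L) (IsCMField.complexConj L) hw) ϖ d m'
            (((n : ↥(unitaryGroupOfForm (conjLocal L (IsCMField.complexConj L) v) (cmLocalForm L 3 v))) : GL (Fin 3) (LocalRing L v)).val.map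
                (Pi.evalRingHom (fun w' : PlacesOver L v => w'.1.adicCompletion L) w) - 1)} =
      {n : ↥(unipotentU (conjLocal L (IsCMField.complexConj L) v) (cmLocalForm L 3 v)) |
        (n : ↥(unitaryGroupOfForm (conjLocal L (IsCMField.complexConj L) v) (cmLocalForm L 3 v))) ∈
            cmLocalIntegralLevel L 3 (Matrix.of fun i j : Fin 3 => if i.val + j.val + 1 = 3 then (1 : L) else 0) v ∧
          NearTransvShell ϖ ℓ m
            (((n : ↥(unitaryGroupOfForm (conjLocal L (IsCMField.complexConj L) v) (cmLocalForm L 3 v))) : GL (Fin 3) (LocalRing L v)).val.map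
                (Pi.evalRingHom (fun w' : PlacesOver L v => w'.1.adicCompletion L) w) - 1)} ∩
      {n : ↥(unipotentU (conjLocal L (IsCMField.complexConj L) v) (cmLocalForm L 3 v)) |
        LabelPlus (galAdicCompletionMap (L := L) (IsCMField.complexConj L) hw) ϖ d m'
            (((n : ↥(unitaryGroupOfForm (conjLocal L (IsCMField.complexConj L) v) (cmLocalForm L 3 v))) : GL (Fin 3) (LocalRing L v)).val.map
                (Pi.evalRingHom (fun w' : PlacesOver L v => w'.1.adicCompletion L) w) - 1)} from by
    ext n; simp only [Set.mem_setOf_eq, Set.mem_inter_iff]; tauto]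
  exact (measurableSet_setOf_mem_and_nearTransvShell L v w hw hϖ ℓ m).inter (isOpen_setOf_labelPlus L v w hw hϖ d m').measurableSet

include hw in
/-- `{n ∈ K₃ : NearTransvShell ϖ ℓ m (n_w − 1) ∧ ¬ LabelPlus σ_w ϖ d m′ (n_w − 1)}` — the support of ★ DEFS №3 `pieceTransvMinus` — is measurable. [cite: Rogawski1990, §4.9 Prop. 4.9.1 (b) p. 55] -/
theorem measurableSet_setOf_mem_and_nearTransvShell_and_not_labelPlus [MeasurableSpace ↥(unipotentU (conjLocal L (IsCMField.complexConj L) v) (cmLocalForm L 3 v))] [BorelSpace ↥(unipotentU (conjLocal L (IsCMField.complexConj L) v) (cmLocalForm L 3 v))]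
    {ϖ : w.1.adicCompletion L} (hϖ : Valued.v ϖ = WithZero.exp (-1 : ℤ)) (ℓ m d m' : ℕ) :
    MeasurableSet {n : ↥(unipotentU (conjLocal L (IsCMField.complexConj L) v) (cmLocalForm L 3 v)) |
        (n : ↥(unitaryGroupOfForm (conjLocal L (IsCMField.complexConj L) v) (cmLocalForm L 3 v))) ∈
            cmLocalIntegralLevel L 3 (Matrix.of fun i j : Fin 3 => if i.val + j.val + 1 = 3 then (1 : L) else 0) v ∧
          NearTransvShell ϖ ℓ m
            (((n : ↥(unitaryGroupOfForm (conjLocal L (IsCMField.complexConj L) v) (cmLocalForm L 3 v))) : GL (Fin 3) (LocalRing L v)).val.map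
                (Pi.evalRingHom (fun w' : PlacesOver L v => w'.1.adicCompletion L) w) - 1) ∧
          ¬ LabelPlus (galAdicCompletionMap (L := L) (IsCMField.complexConj L) hw) ϖ d m'
            (((n : ↥(unitaryGroupOfForm (conjLocal L (IsCMField.complexConj L) v) (cmLocalForm L 3 v))) : GL (Fin 3) (LocalRing L v)).val.map
                (Pi.evalRingHom (fun w' : PlacesOver L v => w'.1.adicCompletion L) w) - 1)} := by
  rw [setOf_mem_and_nearTransvShell_and_not_labelPlus_eq_diff L v w hw ϖ ℓ m d m']
  exact (measurableSet_setOf_mem_and_nearTransvShell L v w hw hϖ ℓ m).diff (measurableSet_setOf_mem_and_nearTransvShell_and_labelPlus L v w hw hϖ ℓ m d m')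

/-- **`μ_N{n ∈ K₃} < ∞`** for every measure finite on compacts (`K₃` is compact open in `U(Φ₃)(L⁺_v)` and `N` is closed, so `N ∩ K₃` is compact in `N`).
[cite: Rogawski1990, §1.10 p. 9] -/
theorem measure_setOf_mem_cmLocalIntegralLevel_lt_top [MeasurableSpace ↥(unipotentU (conjLocal L (IsCMField.complexConj L) v) (cmLocalForm L 3 v))]
    (μN : Measure ↥(unipotentU (conjLocal L (IsCMField.complexConj L) v) (cmLocalForm L 3 v))) [IsFiniteMeasureOnCompacts μN] :
    μN {n : ↥(unipotentU (conjLocal L (IsCMField.complexConj L) v) (cmLocalForm L 3 v)) | (n : ↥(unitaryGroupOfForm (conjLocal L (IsCMField.complexConj L) v) (cmLocalForm L 3 v))) ∈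
          cmLocalIntegralLevel L 3 (Matrix.of fun i j : Fin 3 => if i.val + j.val + 1 = 3 then (1 : L) else 0) v} < ⊤ := by
  obtain ⟨K3, hK3⟩ : ∃ K3 : Subgroup ↥(unitaryGroupOfForm (conjLocal L (IsCMField.complexConj L) v) (cmLocalForm L 3 v)),
      K3 = cmLocalIntegralLevel L 3 (Matrix.of fun i j : Fin 3 => if i.val + j.val + 1 = 3 then (1 : L) else 0) v := ⟨_, rfl⟩
  have hK3c : IsCompact (K3 : Set ↥(unitaryGroupOfForm (conjLocal L (IsCMField.complexConj L) v) (cmLocalForm L 3 v))) := by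
    rw [hK3]; exact (isCompact_isOpen_cmLocalIntegralLevel L 3 (Matrix.of fun i j : Fin 3 => if i.val + j.val + 1 = 3 then (1 : L) else 0) v).1
  have hSK_eq : {n : ↥(unipotentU (conjLocal L (IsCMField.complexConj L) v) (cmLocalForm L 3 v)) | (n : ↥(unitaryGroupOfForm (conjLocal L (IsCMField.complexConj L) v) (cmLocalForm L 3 v))) ∈
          cmLocalIntegralLevel L 3 (Matrix.of fun i j : Fin 3 => if i.val + j.val + 1 = 3 then (1 : L) else 0) v} =
      Subtype.val ⁻¹' (K3 : Set ↥(unitaryGroupOfForm (conjLocal L (IsCMField.complexConj L) v) (cmLocalForm L 3 v))) := by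
    ext n; rw [hK3]; rfl
  rw [hSK_eq]
  exact ((isClosed_cmBorelTriple_N L v).isClosedEmbedding_subtypeVal.isCompact_preimage hK3c).measure_lt_top

/-! ## §3 The shell volume -/

include hw in
/-- **THE SHELL FIBRE VOLUME.**  At a WILD ramified non-split place (`IsRamifiedQuadraticDatum σ_w ϖ d t`, `2 ≤ d`), for EVERY Haar measure `μ_N` of `N`:
`μ_N{n ∈ K₃ : NearTransvShell ϖ (d%2) (d%2+2d−1) (n_w − 1)} = ((1 − q⁻¹)·(q^{d − d∕2})⁻¹) • μ_N{n ∈ K₃}` (`q = N𝔭_v`; shell = `levels(ℓ₀, m*) ∖ levels(ℓ₀+1, m*)`,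
★ p859102 at exponents `d − ⌊d∕2⌋`, `d − ⌊d∕2⌋ + 1`).  F0P3-p01 (g35) FIBRE-VOLUMES: `ρ_shell = (1 − q⁻¹)q^{−⌈d∕2⌉}`.
[cite: Kottwitz1986BaseChangeUnits, §1 pp. 240–241] [cite: Rogawski1990, §4.9 Prop. 4.9.1 (b) p. 55] -/
theorem measure_setOf_mem_and_nearTransvShell_eq [MeasurableSpace ↥(unipotentU (conjLocal L (IsCMField.complexConj L) v) (cmLocalForm L 3 v))] [BorelSpace ↥(unipotentU (conjLocal L (IsCMField.complexConj L) v) (cmLocalForm L 3 v))]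
    (μN : Measure ↥(unipotentU (conjLocal L (IsCMField.complexConj L) v) (cmLocalForm L 3 v))) [μN.IsHaarMeasure]
    (he : v.asIdeal.ramificationIdx' w.1.asIdeal ≠ 1) {ϖ : w.1.adicCompletion L} {d t : ℕ}
    (hD : UnitaryThreeFourFrame.IsRamifiedQuadraticDatum (galAdicCompletionMap (L := L) (IsCMField.complexConj L) hw) ϖ d t) (h2d : 2 ≤ d) :
    μN {n : ↥(unipotentU (conjLocal L (IsCMField.complexConj L) v) (cmLocalForm L 3 v)) |
        (n : ↥(unitaryGroupOfForm (conjLocal L (IsCMField.complexConj L) v) (cmLocalForm L 3 v))) ∈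
            cmLocalIntegralLevel L 3 (Matrix.of fun i j : Fin 3 => if i.val + j.val + 1 = 3 then (1 : L) else 0) v ∧
          NearTransvShell ϖ (d % 2) (d % 2 + 2 * d - 1)
            (((n : ↥(unitaryGroupOfForm (conjLocal L (IsCMField.complexConj L) v) (cmLocalForm L 3 v))) : GL (Fin 3) (LocalRing L v)).val.map
                (Pi.evalRingHom (fun w' : PlacesOver L v => w'.1.adicCompletion L) w) - 1)} =
      (((1 - ((Ideal.absNorm v.asIdeal : ℝ≥0))⁻¹) * ((Ideal.absNorm v.asIdeal : ℝ≥0) ^ (d - d / 2))⁻¹ : ℝ≥0)) •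
        μN {n : ↥(unipotentU (conjLocal L (IsCMField.complexConj L) v) (cmLocalForm L 3 v)) | (n : ↥(unitaryGroupOfForm (conjLocal L (IsCMField.complexConj L) v) (cmLocalForm L 3 v))) ∈
          cmLocalIntegralLevel L 3 (Matrix.of fun i j : Fin 3 => if i.val + j.val + 1 = 3 then (1 : L) else 0) v} := by
  have hϖ : Valued.v ϖ = WithZero.exp (-1 : ℤ) := hD.2.2.1
  have hfin := (measure_setOf_mem_cmLocalIntegralLevel_lt_top L v μN).ne
  have hmono : ∀ e : w.1.adicCompletion L, Valued.v ((ϖ ^ (d % 2 + 1))⁻¹ * e) ≤ 1 → Valued.v ((ϖ ^ (d % 2))⁻¹ * e) ≤ 1 := fun e he1 =>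
    (valued_inv_pow_mul_le_one_iff hϖ _ e).2 (((valued_inv_pow_mul_le_one_iff hϖ _ e).1 he1).trans (WithZero.exp_le_exp.2 (by push_cast; omega)))
  have e1 : (max (max (d % 2) ((d % 2 + 2 * d - 1 + 1) / 2)) ((d % 2 + d) / 2) - d / 2) + (d % 2 - d % 2 + 1) / 2 = d - d / 2 := by omega
  have e2 : (max (max (d % 2 + 1) ((d % 2 + 2 * d - 1 + 1) / 2)) ((d % 2 + 1 + d) / 2) - d / 2) + (d % 2 + 1 - d % 2 + 1) / 2 = d - d / 2 + 1 := by omega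
  rw [setOf_mem_and_nearTransvShell_eq_diff L v w ϖ, measure_sdiff ?_ (isClosed_setOf_mem_and_levels L v w hw hϖ _ _).measurableSet.nullMeasurableSet ?_,
    measure_setOf_mem_and_levels_eq L v w hw μN he hD, measure_setOf_mem_and_levels_eq L v w hw μN he hD, e1, e2,
    ENNReal.sub_smul_of_ne_top _ _ hfin, NNReal.inv_pow_sub_inv_pow_succ (one_le_absNorm_nnreal L v)]
  · exact fun n hn => ⟨hn.1, fun i j => hmono _ (hn.2.1 i j), hn.2.2⟩
  · exact measure_ne_top_of_subset (fun n hn => hn.1) hfin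

/-! ## §4 The `¬LabelPlus` half: `pieceTransvMinus`'s support has volume shell − plus -/

include hw in
/-- **THE `¬LabelPlus` SHELL FIBRE VOLUME** (support of ★ DEFS №3 `pieceTransvMinus` at `dOfPlace = d`, `mstarFn = d%2+2d−1`).  At a WILD ramified non-split place
(`IsRamifiedQuadraticDatum σ_w ϖ d t`, `2 ≤ d`), for EVERY Haar measure `μ_N` of `N`:
`μ_N{n ∈ K₃ : NearTransvShell … (n_w − 1) ∧ ¬ LabelPlus σ_w ϖ d (d%2+2d−1) (n_w − 1)} = ((1 − q⁻¹)(q^{d − d∕2})⁻¹ − ((1 − q⁻¹)∕2)(q^{(d%2+3d−1)∕2 − d∕2})⁻¹) • μ_N{n ∈ K₃}`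
(= shell − plus, ★ §3 and ★ p859349; `ℝ≥0` subtraction, honest since `d − d∕2 ≤ (d%2+3d−1)∕2 − d∕2`).  NOT `shell∕2` unless `d = 2`.
[cite: Rogawski1990, §4.9 Prop. 4.9.1 (b) p. 55] [cite: Serre1979, Ch. V §3 Cor. 3] [cite: Kottwitz1986BaseChangeUnits, §1 pp. 240–241] [cite: LanglandsShelstad1987, §3] -/
theorem measure_setOf_mem_and_nearTransvShell_and_not_labelPlus_eq [MeasurableSpace ↥(unipotentU (conjLocal L (IsCMField.complexConj L) v) (cmLocalForm L 3 v))] [BorelSpace ↥(unipotentU (conjLocal L (IsCMField.complexConj L) v) (cmLocalForm L 3 v))]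
    (μN : Measure ↥(unipotentU (conjLocal L (IsCMField.complexConj L) v) (cmLocalForm L 3 v))) [μN.IsHaarMeasure]
    (he : v.asIdeal.ramificationIdx' w.1.asIdeal ≠ 1) {ϖ : w.1.adicCompletion L} {d t : ℕ}
    (hD : UnitaryThreeFourFrame.IsRamifiedQuadraticDatum (galAdicCompletionMap (L := L) (IsCMField.complexConj L) hw) ϖ d t) (h2d : 2 ≤ d) :
    μN {n : ↥(unipotentU (conjLocal L (IsCMField.complexConj L) v) (cmLocalForm L 3 v)) |
        (n : ↥(unitaryGroupOfForm (conjLocal L (IsCMField.complexConj L) v) (cmLocalForm L 3 v))) ∈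
            cmLocalIntegralLevel L 3 (Matrix.of fun i j : Fin 3 => if i.val + j.val + 1 = 3 then (1 : L) else 0) v ∧
          NearTransvShell ϖ (d % 2) (d % 2 + 2 * d - 1)
            (((n : ↥(unitaryGroupOfForm (conjLocal L (IsCMField.complexConj L) v) (cmLocalForm L 3 v))) : GL (Fin 3) (LocalRing L v)).val.map
                (Pi.evalRingHom (fun w' : PlacesOver L v => w'.1.adicCompletion L) w) - 1) ∧
          ¬ LabelPlus (galAdicCompletionMap (L := L) (IsCMField.complexConj L) hw) ϖ d (d % 2 + 2 * d - 1)
            (((n : ↥(unitaryGroupOfForm (conjLocal L (IsCMField.complexConj L) v) (cmLocalForm L 3 v))) : GL (Fin 3) (LocalRing L v)).val.map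
                (Pi.evalRingHom (fun w' : PlacesOver L v => w'.1.adicCompletion L) w) - 1)} =
      (((1 - ((Ideal.absNorm v.asIdeal : ℝ≥0))⁻¹) * ((Ideal.absNorm v.asIdeal : ℝ≥0) ^ (d - d / 2))⁻¹ -
          (1 - ((Ideal.absNorm v.asIdeal : ℝ≥0))⁻¹) / 2 * ((Ideal.absNorm v.asIdeal : ℝ≥0) ^ ((d % 2 + 3 * d - 1) / 2 - d / 2))⁻¹ : ℝ≥0)) •
        μN {n : ↥(unipotentU (conjLocal L (IsCMField.complexConj L) v) (cmLocalForm L 3 v)) | (n : ↥(unitaryGroupOfForm (conjLocal L (IsCMField.complexConj L) v) (cmLocalForm L 3 v))) ∈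
          cmLocalIntegralLevel L 3 (Matrix.of fun i j : Fin 3 => if i.val + j.val + 1 = 3 then (1 : L) else 0) v} := by
  have hϖ : Valued.v ϖ = WithZero.exp (-1 : ℤ) := hD.2.2.1
  have hfin := (measure_setOf_mem_cmLocalIntegralLevel_lt_top L v μN).ne
  rw [setOf_mem_and_nearTransvShell_and_not_labelPlus_eq_diff L v w hw ϖ,
    measure_sdiff ?_ (measurableSet_setOf_mem_and_nearTransvShell_and_labelPlus L v w hw hϖ _ _ _ _).nullMeasurableSet ?_,
    measure_setOf_mem_and_nearTransvShell_eq L v w hw μN he hD h2d, measure_setOf_mem_and_nearTransvShell_and_labelPlus_eq L v w hw μN he hD h2d,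
    ENNReal.sub_smul_of_ne_top _ _ hfin]
  · exact fun n hn => ⟨hn.1, hn.2.1⟩
  · exact measure_ne_top_of_subset (fun n hn => hn.1) hfin

/-! ## §5 The three volumes in `μ_N.real` currency (row (3) consumers) -/

include hw in
/-- `μ_N.real` form of ★ p859349: `μ_N.real{n ∈ K₃ : shell ∧ LabelPlus} = ((1 − q⁻¹)∕2·(q^{(d%2+3d−1)∕2 − d∕2})⁻¹)·μ_N.real{n ∈ K₃}` (`ρ_{T+} = ½(1 − q⁻¹)q^{−(d−1+ℓ₀)}`).
[cite: Rogawski1990, §4.9 Prop. 4.9.1 (b) p. 55] [cite: LanglandsShelstad1987, §3] -/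
theorem measureReal_setOf_mem_and_nearTransvShell_and_labelPlus_eq [MeasurableSpace ↥(unipotentU (conjLocal L (IsCMField.complexConj L) v) (cmLocalForm L 3 v))] [BorelSpace ↥(unipotentU (conjLocal L (IsCMField.complexConj L) v) (cmLocalForm L 3 v))]
    (μN : Measure ↥(unipotentU (conjLocal L (IsCMField.complexConj L) v) (cmLocalForm L 3 v))) [μN.IsHaarMeasure]
    (he : v.asIdeal.ramificationIdx' w.1.asIdeal ≠ 1) {ϖ : w.1.adicCompletion L} {d t : ℕ}
    (hD : UnitaryThreeFourFrame.IsRamifiedQuadraticDatum (galAdicCompletionMap (L := L) (IsCMField.complexConj L) hw) ϖ d t) (h2d : 2 ≤ d) :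
    μN.real {n : ↥(unipotentU (conjLocal L (IsCMField.complexConj L) v) (cmLocalForm L 3 v)) |
        (n : ↥(unitaryGroupOfForm (conjLocal L (IsCMField.complexConj L) v) (cmLocalForm L 3 v))) ∈
            cmLocalIntegralLevel L 3 (Matrix.of fun i j : Fin 3 => if i.val + j.val + 1 = 3 then (1 : L) else 0) v ∧
          NearTransvShell ϖ (d % 2) (d % 2 + 2 * d - 1)
            (((n : ↥(unitaryGroupOfForm (conjLocal L (IsCMField.complexConj L) v) (cmLocalForm L 3 v))) : GL (Fin 3) (LocalRing L v)).val.map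
                (Pi.evalRingHom (fun w' : PlacesOver L v => w'.1.adicCompletion L) w) - 1) ∧
          LabelPlus (galAdicCompletionMap (L := L) (IsCMField.complexConj L) hw) ϖ d (d % 2 + 2 * d - 1)
            (((n : ↥(unitaryGroupOfForm (conjLocal L (IsCMField.complexConj L) v) (cmLocalForm L 3 v))) : GL (Fin 3) (LocalRing L v)).val.map
                (Pi.evalRingHom (fun w' : PlacesOver L v => w'.1.adicCompletion L) w) - 1)} =
      ((1 - ((Ideal.absNorm v.asIdeal : ℝ))⁻¹) / 2 * ((Ideal.absNorm v.asIdeal : ℝ) ^ ((d % 2 + 3 * d - 1) / 2 - d / 2))⁻¹) *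
        μN.real {n : ↥(unipotentU (conjLocal L (IsCMField.complexConj L) v) (cmLocalForm L 3 v)) | (n : ↥(unitaryGroupOfForm (conjLocal L (IsCMField.complexConj L) v) (cmLocalForm L 3 v))) ∈
          cmLocalIntegralLevel L 3 (Matrix.of fun i j : Fin 3 => if i.val + j.val + 1 = 3 then (1 : L) else 0) v} := by
  have hle1 : ((Ideal.absNorm v.asIdeal : ℝ≥0))⁻¹ ≤ 1 := inv_le_one_of_one_le₀ (one_le_absNorm_nnreal L v)
  rw [measureReal_def, measureReal_def, measure_setOf_mem_and_nearTransvShell_and_labelPlus_eq L v w hw μN he hD h2d, ENNReal.toReal_smul, NNReal.smul_def,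
    smul_eq_mul, NNReal.coe_mul, NNReal.coe_div, NNReal.coe_sub hle1]
  push_cast
  ring

include hw in
/-- `μ_N.real` form of §3: `μ_N.real{n ∈ K₃ : shell} = ((1 − q⁻¹)·(q^{d − d∕2})⁻¹)·μ_N.real{n ∈ K₃}` (`ρ_shell = (1 − q⁻¹)q^{−⌈d∕2⌉}`).
[cite: Kottwitz1986BaseChangeUnits, §1 pp. 240–241] -/
theorem measureReal_setOf_mem_and_nearTransvShell_eq [MeasurableSpace ↥(unipotentU (conjLocal L (IsCMField.complexConj L) v) (cmLocalForm L 3 v))] [BorelSpace ↥(unipotentU (conjLocal L (IsCMField.complexConj L) v) (cmLocalForm L 3 v))]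
    (μN : Measure ↥(unipotentU (conjLocal L (IsCMField.complexConj L) v) (cmLocalForm L 3 v))) [μN.IsHaarMeasure]
    (he : v.asIdeal.ramificationIdx' w.1.asIdeal ≠ 1) {ϖ : w.1.adicCompletion L} {d t : ℕ}
    (hD : UnitaryThreeFourFrame.IsRamifiedQuadraticDatum (galAdicCompletionMap (L := L) (IsCMField.complexConj L) hw) ϖ d t) (h2d : 2 ≤ d) :
    μN.real {n : ↥(unipotentU (conjLocal L (IsCMField.complexConj L) v) (cmLocalForm L 3 v)) |
        (n : ↥(unitaryGroupOfForm (conjLocal L (IsCMField.complexConj L) v) (cmLocalForm L 3 v))) ∈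
            cmLocalIntegralLevel L 3 (Matrix.of fun i j : Fin 3 => if i.val + j.val + 1 = 3 then (1 : L) else 0) v ∧
          NearTransvShell ϖ (d % 2) (d % 2 + 2 * d - 1)
            (((n : ↥(unitaryGroupOfForm (conjLocal L (IsCMField.complexConj L) v) (cmLocalForm L 3 v))) : GL (Fin 3) (LocalRing L v)).val.map
                (Pi.evalRingHom (fun w' : PlacesOver L v => w'.1.adicCompletion L) w) - 1)} =
      ((1 - ((Ideal.absNorm v.asIdeal : ℝ))⁻¹) * ((Ideal.absNorm v.asIdeal : ℝ) ^ (d - d / 2))⁻¹) *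
        μN.real {n : ↥(unipotentU (conjLocal L (IsCMField.complexConj L) v) (cmLocalForm L 3 v)) | (n : ↥(unitaryGroupOfForm (conjLocal L (IsCMField.complexConj L) v) (cmLocalForm L 3 v))) ∈
          cmLocalIntegralLevel L 3 (Matrix.of fun i j : Fin 3 => if i.val + j.val + 1 = 3 then (1 : L) else 0) v} := by
  have hle1 : ((Ideal.absNorm v.asIdeal : ℝ≥0))⁻¹ ≤ 1 := inv_le_one_of_one_le₀ (one_le_absNorm_nnreal L v)
  rw [measureReal_def, measureReal_def, measure_setOf_mem_and_nearTransvShell_eq L v w hw μN he hD h2d, ENNReal.toReal_smul, NNReal.smul_def,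
    smul_eq_mul, NNReal.coe_mul, NNReal.coe_sub hle1]
  push_cast
  ring

include hw in
/-- **`μ_N.real` form of §4 with REAL subtraction**: `μ_N.real{n ∈ K₃ : shell ∧ ¬LabelPlus} = (1 − q⁻¹)·((q^{d − d∕2})⁻¹ − (q^{(d%2+3d−1)∕2 − d∕2})⁻¹∕2)·μ_N.real{n ∈ K₃}`
(`ρ_{T−} = ρ_shell − ρ_{T+} = (1 − q⁻¹)(q^{−⌈d∕2⌉} − ½q^{−(d−1+ℓ₀)})`; the support of ★ DEFS №3 `pieceTransvMinus`).
[cite: Rogawski1990, §4.9 Prop. 4.9.1 (b) p. 55] [cite: Serre1979, Ch. V §3 Cor. 3] [cite: LanglandsShelstad1987, §3] -/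
theorem measureReal_setOf_mem_and_nearTransvShell_and_not_labelPlus_eq [MeasurableSpace ↥(unipotentU (conjLocal L (IsCMField.complexConj L) v) (cmLocalForm L 3 v))] [BorelSpace ↥(unipotentU (conjLocal L (IsCMField.complexConj L) v) (cmLocalForm L 3 v))]
    (μN : Measure ↥(unipotentU (conjLocal L (IsCMField.complexConj L) v) (cmLocalForm L 3 v))) [μN.IsHaarMeasure]
    (he : v.asIdeal.ramificationIdx' w.1.asIdeal ≠ 1) {ϖ : w.1.adicCompletion L} {d t : ℕ}
    (hD : UnitaryThreeFourFrame.IsRamifiedQuadraticDatum (galAdicCompletionMap (L := L) (IsCMField.complexConj L) hw) ϖ d t) (h2d : 2 ≤ d) :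
    μN.real {n : ↥(unipotentU (conjLocal L (IsCMField.complexConj L) v) (cmLocalForm L 3 v)) |
        (n : ↥(unitaryGroupOfForm (conjLocal L (IsCMField.complexConj L) v) (cmLocalForm L 3 v))) ∈
            cmLocalIntegralLevel L 3 (Matrix.of fun i j : Fin 3 => if i.val + j.val + 1 = 3 then (1 : L) else 0) v ∧
          NearTransvShell ϖ (d % 2) (d % 2 + 2 * d - 1)
            (((n : ↥(unitaryGroupOfForm (conjLocal L (IsCMField.complexConj L) v) (cmLocalForm L 3 v))) : GL (Fin 3) (LocalRing L v)).val.map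
                (Pi.evalRingHom (fun w' : PlacesOver L v => w'.1.adicCompletion L) w) - 1) ∧
          ¬ LabelPlus (galAdicCompletionMap (L := L) (IsCMField.complexConj L) hw) ϖ d (d % 2 + 2 * d - 1)
            (((n : ↥(unitaryGroupOfForm (conjLocal L (IsCMField.complexConj L) v) (cmLocalForm L 3 v))) : GL (Fin 3) (LocalRing L v)).val.map
                (Pi.evalRingHom (fun w' : PlacesOver L v => w'.1.adicCompletion L) w) - 1)} =
      ((1 - ((Ideal.absNorm v.asIdeal : ℝ))⁻¹) *
          (((Ideal.absNorm v.asIdeal : ℝ) ^ (d - d / 2))⁻¹ - ((Ideal.absNorm v.asIdeal : ℝ) ^ ((d % 2 + 3 * d - 1) / 2 - d / 2))⁻¹ / 2)) *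
        μN.real {n : ↥(unipotentU (conjLocal L (IsCMField.complexConj L) v) (cmLocalForm L 3 v)) | (n : ↥(unitaryGroupOfForm (conjLocal L (IsCMField.complexConj L) v) (cmLocalForm L 3 v))) ∈
          cmLocalIntegralLevel L 3 (Matrix.of fun i j : Fin 3 => if i.val + j.val + 1 = 3 then (1 : L) else 0) v} := by
  have hϖ : Valued.v ϖ = WithZero.exp (-1 : ℤ) := hD.2.2.1
  have hfin := (measure_setOf_mem_cmLocalIntegralLevel_lt_top L v μN).ne
  rw [setOf_mem_and_nearTransvShell_and_not_labelPlus_eq_diff L v w hw ϖ,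
    measureReal_sdiff ?_ (measurableSet_setOf_mem_and_nearTransvShell_and_labelPlus L v w hw hϖ _ _ _ _) ?_,
    measureReal_setOf_mem_and_nearTransvShell_eq L v w hw μN he hD h2d, measureReal_setOf_mem_and_nearTransvShell_and_labelPlus_eq L v w hw μN he hD h2d]
  · ring
  · exact fun n hn => ⟨hn.1, hn.2.1⟩
  · exact measure_ne_top_of_subset (fun n hn => hn.1) hfin

end Summit.HodgeConjecture.HodgeConjecture.Cruxes.H413.F0P3cDyRamTransvMinusUnipotentVolume

end
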